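import Summits.ResolutionOfSingularities.ResolutionOfSingularities.Theorems.FrobeniusClosingSteerToricUnitExitStep

/-!
# Crux `Steer` (stmt-ResolutionOfSingularities-16345) — K-TX part 4d, the genuine pair step WITH ITS CHART EXPOSED

OURS; [cite: NovacoskiSpivakovsky2014, Def. 2.11]; [cite: DeJong1996, 2.4].

`…ToricUnitExitStep.frame_step_div` moves a frame `(R, z)` along a genuine pair blow-up to SOME `R'`; the transport map `Φ` of the
stale-unit route (`…ToricUnitExitTarget`, `ResCompat.exists_extend_chart` / `exists_extend_locAtCentre`) needs the chart itself:
`R' = (R[z_b/z_a])_{centre}` presented as `locAtCentre (Subring.closure (R ∪ {c_j/c_0})) O` for a QUASI-REGULAR pair `c = (z_a, z_b)` of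
elements of `R`.  `frame_step_div_chart` is `frame_step_div` with exactly this data exposed (same proof, the quasi-regularity of `c` read
off the regular system of parameters by `isQuasiRegular_rsop_comp`).

Contents (namespace `…Theorems.SteerToricUnitExit`): `frame_step_div_chart`.
-/

noncomputable section

-- single-problem summit: the doubled namespace component `ResolutionOfSingularities` is forced
set_option linter.dupNamespace false

open scoped BigOperators

namespace Summit.ResolutionOfSingularities.ResolutionOfSingularities.Theorems.SteerToricUnitExit

open IsLocalRing
open Literature.AlgebraicGeometry.Resolution
open Summit.ResolutionOfSingularities.ResolutionOfSingularities.Theorems.SwitchingDichotomy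
open Summit.ResolutionOfSingularities.ResolutionOfSingularities.Theorems.SteerToricVertexSplit

variable {K : Type} [Field K]

section DivStepChart

variable {n : ℕ}

/-- **The genuine pair step with its chart.** For a frame `(R, z)`, letters `a ≠ b` with `z_a` a NON-unit and `v(z_b) ≤ v(z_a)`
(multiplicative notation: `z_b/z_a ∈ O`): there is a quasi-regular pair `c = (z_a, z_b)` of elements of `R` (part of a regular system of
parameters) such that, with the chart `C = R[c_j/c_0] ⊆ K` and `R' = C_{centre of O}`: `IsLocalBlowup O R R'` and `(R', update z b (z_b/z_a))`
is again a frame. OURS. [cite: NovacoskiSpivakovsky2014, Def. 2.11] [cite: DeJong1996, 2.4] -/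
theorem frame_step_div_chart (O : ValuationSubring K) (R : Subring K) (z : Fin n → K) (hF : Frame O R z) {a b : Fin n}
    (hab : a ≠ b) (hva : O.valuation (z a) < 1) (hle : O.valuation (z b) ≤ O.valuation (z a)) :
    ∃ c : Fin 2 → R, ((c 0 : R) : K) = z a ∧ ((c 1 : R) : K) = z b ∧ IsQuasiRegular c ∧ c 0 ≠ 0 ∧
      (∀ j, O.valuation ((c j : R) : K) ≤ O.valuation ((c 0 : R) : K)) ∧
      IsLocalBlowup O R (locAtCentre
        (Subring.closure ((R : Set K) ∪ Set.range fun j => ((c j : R) : K) / ((c 0 : R) : K))) O) ∧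
      Frame O (locAtCentre (Subring.closure ((R : Set K) ∪ Set.range fun j => ((c j : R) : K) / ((c 0 : R) : K))) O)
        (Function.update z b (z b / z a)) := by
  classical
  obtain ⟨hreg, hRO, hRloc, hcen, hz0, hz, d, x, pos, hxspan, hxd, hxz, hinj⟩ := hF
  have hvb : O.valuation (z b) < 1 := lt_of_le_of_lt hle hva
  have hpos : pos a ≠ pos b := fun e => hab (hinj a b hva hvb e)
  -- `d = 2 + l`, and a minimal basis `x₁ = x ∘ σ` starting with `z_a, z_b`
  have h2d : 2 ≤ d := by
    have := Fintype.card_le_of_injective (![pos a, pos b] : Fin 2 → Fin d) (by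
      intro i j hij; fin_cases i <;> fin_cases j
      · rfl
      · exact absurd hij hpos
      · exact absurd hij.symm hpos
      · rfl)
    simpa using this
  obtain ⟨l, rfl⟩ : ∃ l, d = 2 + l := ⟨d - 2, by omega⟩
  obtain ⟨σ, hσ0, hσ1⟩ := exists_perm_first_two (pos a) (pos b) hpos
  set x₁ : Fin (2 + l) → R := x ∘ σ with hx₁
  have hx₁span : Ideal.span (Set.range x₁) = maximalIdeal R := by rw [hx₁, σ.surjective.range_comp, hxspan]
  set c : Fin 2 → R := fun j => x₁ (Fin.castAdd l j) with hc
  set w : Fin l → R := fun j => x₁ (Fin.natAdd 2 j) with hw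
  have hcw : Fin.append c w = x₁ := Fin.append_castAdd_natAdd
  have hc0 : ((c 0 : R) : K) = z a := by
    show ((x (σ (Fin.castAdd l 0)) : R) : K) = z a
    rw [hσ0, hxz a hva]
  have hc1 : ((c 1 : R) : K) = z b := by
    show ((x (σ (Fin.castAdd l 1)) : R) : K) = z b
    rw [hσ1, hxz b hvb]
  have hzspan : Ideal.span (Set.range (Fin.append c w)) = maximalIdeal R := by rw [hcw, hx₁span]
  have hci : c 0 ≠ 0 := fun e => hz0 a (by rw [← hc0, e]; rfl)
  have hmax : ∀ j : Fin 2, O.valuation ((c j : R) : K) ≤ O.valuation ((c 0 : R) : K) := by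
    intro j; fin_cases j
    · exact le_rfl
    · show O.valuation ((c 1 : R) : K) ≤ O.valuation ((c 0 : R) : K)
      rw [hc0, hc1]; exact hle
  -- `c` is quasi-regular (part of the regular system of parameters `(c, w)`)
  have hqr : IsQuasiRegular c := by
    haveI := hreg
    have hq := isQuasiRegular_rsop_comp hxd (Fin.append c w) hzspan (Fin.castAdd l) (Fin.castAdd_injective _ _)
    have hcomp : Fin.append c w ∘ Fin.castAdd l = c := funext fun j => by simp
    rwa [hcomp] at hq
  -- the chart and the local blowing up
  set C : Subring K := Subring.closure ((R : Set K) ∪ Set.range fun j => ((c j : R) : K) / ((c 0 : R) : K)) with hCdef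
  have hCO : C ≤ O.toSubring := ChartRsop.closure_chart_le hRO c 0 hci hmax
  set R' : Subring K := locAtCentre C O with hR'def
  haveI hloc' : IsLocalRing R' := isLocalRing_locAtCentre hCO
  have hR'O : R' ≤ O.toSubring := locAtCentre_le hCO
  have hRC : R ≤ C := ChartRsop.le_closure_chart R c 0
  have hCR' : C ≤ R' := le_locAtCentre C O
  have hu_mem : z b / z a ∈ R' := by
    have h := ChartRsop.div_mem_closure_chart R c 0 1
    have e : ((c 1 : R) : K) / ((c 0 : R) : K) = z b / z a := by rw [hc0, hc1]
    rw [e] at h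
    exact hCR' h
  refine ⟨c, hc0, hc1, hqr, hci, hmax, ⟨hRO, Finset.univ.image fun j => ((c j : R) : K) / ((c 0 : R) : K), ?_, ?_⟩, ?_⟩
  · intro q hq
    rw [Finset.coe_image, Finset.coe_univ, Set.image_univ] at hq
    obtain ⟨j, rfl⟩ := hq
    have hv0 : O.valuation ((c 0 : R) : K) ≠ 0 := by rw [hc0]; exact (map_ne_zero _).mpr (hz0 a)
    change ((c j : R) : K) / ((c 0 : R) : K) ∈ O
    rw [← O.valuation_le_one_iff, map_div₀, div_le_one₀ (zero_lt_iff.mpr hv0)]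
    exact hmax j
  · rw [Finset.coe_image, Finset.coe_univ, Set.image_univ]
  -- the frame of `R'`
  have hcen' : ∀ q : R', q ∈ maximalIdeal R' ↔ O.valuation (q : K) < 1 := fun q => mem_maximalIdeal_locAtCentre_iff hCO q
  have hz' : ∀ j, Function.update z b (z b / z a) j ∈ R' := fun j => by
    by_cases h : j = b
    · subst h; rw [Function.update_self]; exact hu_mem
    · rw [Function.update_of_ne h]; exact hCR' (hRC (hz j))
  have hvq : ∀ j, j ≠ b → ∀ q : K, Function.update z b q j = z j := fun j h q => Function.update_of_ne h _ _
  -- the two cases: `u` a non-unit or a unit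
  by_cases hu : O.valuation (z b / z a) < 1
  · -- `u` non-unit: the chart family `(z_a, u, w)` is part of a regular system of parameters of `R'`
    let jJ : Fin 1 → {j : Fin 2 // j ≠ 0} := fun _ => ⟨1, one_ne_zero⟩
    have hjJ : Function.Injective jJ := fun i j _ => Subsingleton.elim i j
    have hJ : ∀ k, O.valuation (((c (jJ k).1 : R) : K) / ((c 0 : R) : K)) < 1 := fun k => by
      show O.valuation (((c 1 : R) : K) / ((c 0 : R) : K)) < 1
      rw [hc0, hc1]; exact hu
    have hfam := ChartRsop.isRsopPart_chartFamily_closure hRO hcen c w hzspan hxd 0 hci hmax jJ hjJ hJ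
    obtain ⟨e, x', hd', hspan', hx'F⟩ := hfam.exists_rsop
    -- positions: `a ↦ 0`, `b ↦ 1`, other non-unit `j ↦ 2 + (σ⁻¹ (pos j) − 2)`
    let q : Fin n → Fin (1 + l + 1) := fun j =>
      if j = a then 0 else if j = b then ⟨1, by omega⟩ else
        if h : 2 ≤ (σ.symm (pos j)).val then ⟨(σ.symm (pos j)).val, by have := (σ.symm (pos j)).isLt; omega⟩ else 0
    refine ⟨hfam.isRegularLocalRing, hR'O, locAtCentre_locAtCentre C O, hcen', update_div_ne_zero z hz0 a b, hz',
      (1 + l + 1) + e, x', fun j => Fin.castAdd e (q j), hspan', hd', fun j hj => ?_, fun j j' hj hj' hqq => ?_⟩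
    · -- `x' (pos' j) = z' j`
      rw [hx'F]
      by_cases hja : j = a
      · subst hja
        have hq : q j = 0 := by simp [q]
        rw [hq, hvq j hab]
        show ((chartFamily c 0 w R' (Subring.inclusion hRC) (fun j => ⟨((c j : R) : K) / ((c 0 : R) : K),
          ChartRsop.div_mem_closure_chart R c 0 j⟩) jJ 0 : R') : K) = z j
        rw [chartFamily, Fin.cons_zero]
        exact hc0
      by_cases hjb : j = b
      · subst hjb
        have hq : q j = ⟨1, by omega⟩ := by simp [q, hja]
        rw [hq, Function.update_self]
        have e1 : (⟨1, by omega⟩ : Fin (1 + l + 1)) = Fin.succ (Fin.castAdd l (0 : Fin 1)) := rfl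
        show ((chartFamily c 0 w R' (Subring.inclusion hRC) (fun j => ⟨((c j : R) : K) / ((c 0 : R) : K),
          ChartRsop.div_mem_closure_chart R c 0 j⟩) jJ ⟨1, by omega⟩ : R') : K) = z j / z a
        rw [e1, chartFamily, Fin.cons_succ, Fin.append_left]
        show ((c 1 : R) : K) / ((c 0 : R) : K) = z j / z a
        rw [hc0, hc1]
      · -- another non-unit letter: it sits in `w`
        have hjv : O.valuation (z j) < 1 := by rwa [hvq j hjb] at hj
        have hne0 : σ.symm (pos j) ≠ Fin.castAdd l 0 := fun e => by
          have : pos j = pos a := by rw [← hσ0, ← e, Equiv.apply_symm_apply]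
          exact hja (hinj j a hjv hva this)
        have hne1 : σ.symm (pos j) ≠ Fin.castAdd l 1 := fun e => by
          have : pos j = pos b := by rw [← hσ1, ← e, Equiv.apply_symm_apply]
          exact hjb (hinj j b hjv hvb this)
        have h2 : 2 ≤ (σ.symm (pos j)).val := by
          by_contra hlt
          push Not at hlt
          interval_cases hv : (σ.symm (pos j)).val
          · exact hne0 (Fin.ext hv)
          · exact hne1 (Fin.ext hv)
        set kk : Fin l := ⟨(σ.symm (pos j)).val - 2, by have := (σ.symm (pos j)).isLt; omega⟩ with hkk
        have hq : q j = ⟨(σ.symm (pos j)).val, by have := (σ.symm (pos j)).isLt; omega⟩ := by simp [q, hja, hjb, h2]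
        have e1 : (⟨(σ.symm (pos j)).val, by have := (σ.symm (pos j)).isLt; omega⟩ : Fin (1 + l + 1)) =
            Fin.succ (Fin.natAdd 1 kk) := by
          apply Fin.ext; simp [hkk]; omega
        rw [hq, hvq j hjb, e1]
        show ((chartFamily c 0 w R' (Subring.inclusion hRC) (fun j => ⟨((c j : R) : K) / ((c 0 : R) : K),
          ChartRsop.div_mem_closure_chart R c 0 j⟩) jJ (Fin.succ (Fin.natAdd 1 kk)) : R') : K) = z j
        rw [chartFamily, Fin.cons_succ, Fin.append_right]
        show ((w kk : R) : K) = z j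
        have e2 : Fin.natAdd 2 kk = σ.symm (pos j) := by apply Fin.ext; simp [hkk]; omega
        show ((x (σ (Fin.natAdd 2 kk)) : R) : K) = z j
        rw [e2, Equiv.apply_symm_apply, hxz j hjv]
    · -- injectivity of the new positions on the non-unit letters
      have hqq' : q j = q j' := Fin.castAdd_injective _ _ hqq
      -- values of `q` on non-unit letters: `a ↦ 0`, `b ↦ 1`, others `↦ ≥ 2` and injective
      have hval : ∀ i, O.valuation (Function.update z b (z b / z a) i) < 1 →
          (i = a ∧ (q i).val = 0) ∨ (i = b ∧ (q i).val = 1) ∨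
            (i ≠ a ∧ i ≠ b ∧ O.valuation (z i) < 1 ∧ (q i).val = (σ.symm (pos i)).val ∧ 2 ≤ (q i).val) := by
        intro i hi
        by_cases hia : i = a
        · subst hia; left; exact ⟨rfl, by simp [q]⟩
        by_cases hib : i = b
        · subst hib; right; left; exact ⟨rfl, by simp [q, hia]⟩
        right; right
        have hiv : O.valuation (z i) < 1 := by rwa [hvq i hib] at hi
        have hne0 : σ.symm (pos i) ≠ Fin.castAdd l 0 := fun e => by
          have : pos i = pos a := by rw [← hσ0, ← e, Equiv.apply_symm_apply]
          exact hia (hinj i a hiv hva this)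
        have hne1 : σ.symm (pos i) ≠ Fin.castAdd l 1 := fun e => by
          have : pos i = pos b := by rw [← hσ1, ← e, Equiv.apply_symm_apply]
          exact hib (hinj i b hiv hvb this)
        have h2 : 2 ≤ (σ.symm (pos i)).val := by
          by_contra hlt
          push Not at hlt
          interval_cases hv : (σ.symm (pos i)).val
          · exact hne0 (Fin.ext hv)
          · exact hne1 (Fin.ext hv)
        have hq : (q i).val = (σ.symm (pos i)).val := by simp [q, hia, hib, h2]
        exact ⟨hia, hib, hiv, hq, hq ▸ h2⟩
      have hv := congrArg Fin.val hqq'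
      rcases hval j hj with ⟨rfl, h0⟩ | ⟨rfl, h1⟩ | ⟨hja, hjb, hjv, hjq, hj2⟩ <;>
        rcases hval j' hj' with ⟨rfl, h0'⟩ | ⟨rfl, h1'⟩ | ⟨hja', hjb', hjv', hjq', hj2'⟩
      all_goals first | rfl | omega | skip
      · -- both «other»: `σ.symm (pos j) = σ.symm (pos j')`
        have e : σ.symm (pos j) = σ.symm (pos j') := Fin.ext (by omega)
        exact hinj j j' hjv hjv' (σ.symm.injective e)
  · -- `u` a unit: the chart family `(z_a, w)` is part of a regular system of parameters of `R'`
    let jJ : Fin 0 → {j : Fin 2 // j ≠ 0} := Fin.elim0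
    have hjJ : Function.Injective jJ := fun i => i.elim0
    have hJ : ∀ k, O.valuation (((c (jJ k).1 : R) : K) / ((c 0 : R) : K)) < 1 := fun k => k.elim0
    have hfam := ChartRsop.isRsopPart_chartFamily_closure hRO hcen c w hzspan hxd 0 hci hmax jJ hjJ hJ
    obtain ⟨e, x', hd', hspan', hx'F⟩ := hfam.exists_rsop
    let q : Fin n → Fin (0 + l + 1) := fun j =>
      if j = a then 0 else
        if h : 2 ≤ (σ.symm (pos j)).val then ⟨(σ.symm (pos j)).val - 1, by have := (σ.symm (pos j)).isLt; omega⟩ else 0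
    refine ⟨hfam.isRegularLocalRing, hR'O, locAtCentre_locAtCentre C O, hcen', update_div_ne_zero z hz0 a b, hz',
      (0 + l + 1) + e, x', fun j => Fin.castAdd e (q j), hspan', hd', fun j hj => ?_, fun j j' hj hj' hqq => ?_⟩
    · rw [hx'F]
      have hjb : j ≠ b := by rintro rfl; rw [Function.update_self] at hj; exact hu hj
      by_cases hja : j = a
      · subst hja
        have hq : q j = 0 := by simp [q]
        rw [hq, hvq j hab]
        show ((chartFamily c 0 w R' (Subring.inclusion hRC) (fun j => ⟨((c j : R) : K) / ((c 0 : R) : K),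
          ChartRsop.div_mem_closure_chart R c 0 j⟩) jJ 0 : R') : K) = z j
        rw [chartFamily, Fin.cons_zero]
        exact hc0
      · have hjv : O.valuation (z j) < 1 := by rwa [hvq j hjb] at hj
        have hne0 : σ.symm (pos j) ≠ Fin.castAdd l 0 := fun e => by
          have : pos j = pos a := by rw [← hσ0, ← e, Equiv.apply_symm_apply]
          exact hja (hinj j a hjv hva this)
        have hne1 : σ.symm (pos j) ≠ Fin.castAdd l 1 := fun e => by
          have : pos j = pos b := by rw [← hσ1, ← e, Equiv.apply_symm_apply]
          exact hjb (hinj j b hjv hvb this)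
        have h2 : 2 ≤ (σ.symm (pos j)).val := by
          by_contra hlt
          push Not at hlt
          interval_cases hv : (σ.symm (pos j)).val
          · exact hne0 (Fin.ext hv)
          · exact hne1 (Fin.ext hv)
        set kk : Fin l := ⟨(σ.symm (pos j)).val - 2, by have := (σ.symm (pos j)).isLt; omega⟩ with hkk
        have hq : q j = ⟨(σ.symm (pos j)).val - 1, by have := (σ.symm (pos j)).isLt; omega⟩ := by simp [q, hja, h2]
        have e1 : (⟨(σ.symm (pos j)).val - 1, by have := (σ.symm (pos j)).isLt; omega⟩ : Fin (0 + l + 1)) =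
            Fin.succ (Fin.natAdd 0 kk) := by
          apply Fin.ext; simp [hkk]; omega
        rw [hq, hvq j hjb, e1]
        show ((chartFamily c 0 w R' (Subring.inclusion hRC) (fun j => ⟨((c j : R) : K) / ((c 0 : R) : K),
          ChartRsop.div_mem_closure_chart R c 0 j⟩) jJ (Fin.succ (Fin.natAdd 0 kk)) : R') : K) = z j
        rw [chartFamily, Fin.cons_succ, Fin.append_right]
        show ((w kk : R) : K) = z j
        have e2 : Fin.natAdd 2 kk = σ.symm (pos j) := by apply Fin.ext; simp [hkk]; omega
        show ((x (σ (Fin.natAdd 2 kk)) : R) : K) = z j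
        rw [e2, Equiv.apply_symm_apply, hxz j hjv]
    · have hqq' : q j = q j' := Fin.castAdd_injective _ _ hqq
      have hval : ∀ i, O.valuation (Function.update z b (z b / z a) i) < 1 →
          (i = a ∧ (q i).val = 0) ∨
            (i ≠ a ∧ i ≠ b ∧ O.valuation (z i) < 1 ∧ (q i).val + 1 = (σ.symm (pos i)).val ∧ 1 ≤ (q i).val) := by
        intro i hi
        have hib : i ≠ b := by rintro rfl; rw [Function.update_self] at hi; exact hu hi
        by_cases hia : i = a
        · subst hia; left; exact ⟨rfl, by simp [q]⟩
        right
        have hiv : O.valuation (z i) < 1 := by rwa [hvq i hib] at hi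
        have hne0 : σ.symm (pos i) ≠ Fin.castAdd l 0 := fun e => by
          have : pos i = pos a := by rw [← hσ0, ← e, Equiv.apply_symm_apply]
          exact hia (hinj i a hiv hva this)
        have hne1 : σ.symm (pos i) ≠ Fin.castAdd l 1 := fun e => by
          have : pos i = pos b := by rw [← hσ1, ← e, Equiv.apply_symm_apply]
          exact hib (hinj i b hiv hvb this)
        have h2 : 2 ≤ (σ.symm (pos i)).val := by
          by_contra hlt
          push Not at hlt
          interval_cases hv : (σ.symm (pos i)).val
          · exact hne0 (Fin.ext hv)
          · exact hne1 (Fin.ext hv)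
        have hq : (q i).val = (σ.symm (pos i)).val - 1 := by simp [q, hia, h2]
        exact ⟨hia, hib, hiv, by omega, by omega⟩
      have hv := congrArg Fin.val hqq'
      rcases hval j hj with ⟨rfl, h0⟩ | ⟨hja, hjb, hjv, hjq, hj2⟩ <;>
        rcases hval j' hj' with ⟨rfl, h0'⟩ | ⟨hja', hjb', hjv', hjq', hj2'⟩
      all_goals first | rfl | omega | skip
      · have e : σ.symm (pos j) = σ.symm (pos j') := Fin.ext (by omega)
        exact hinj j j' hjv hjv' (σ.symm.injective e)

end DivStepChart

end Summit.ResolutionOfSingularities.ResolutionOfSingularities.Theorems.SteerToricUnitExit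

end
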